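import Literature.Geometry.Lorentzian.LinearConstraintMoments
import Mathlib.LinearAlgebra.Matrix.NonsingularInverse
import Mathlib.LinearAlgebra.Matrix.PosDef
import HarnessLib

/-!
# Splitting a density with vanishing moments (the gluing step of Mao–Oh–Tao's Lemma 2.2)

(trunk G08 = T-LORENTZ; family `gr`; namespace `Literature.Geometry.Lorentzian.MaoOhTao`.)

Mao–Oh–Tao (arXiv:2308.13031), proof of Lemma 2.2 (p. 9): Bogovskiĭ-type operators on two open sets `U₁, U₂` are
glued to one on `U₁ ∪ U₂` by splitting the density.  With `g₀ = 1`, `g_j = x_j`, a bump `η ∈ C^∞_c(U₁ ∩ U₂)`,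
`η ≠ 0`, and a partition of unity `χ₁ + χ₂ = 1` subordinate to `{U₁, U₂}`, one sets

  `G_{μν} = ∫ g_μ g_ν η² dx`  (positive definite),  `θ^μ = (G⁻¹)^{μν} g_ν η²`  (so `∫ θ^μ g_{μ'} = δ^μ_{μ'}`),
  `f_k = f χ_k − (∫ f χ_k) θ⁰ − Σ_j (∫ f χ_k x_j) θ^j`,

so that `supp f_k ⊆ U_k`, `∫ f_k (1, x₁, x₂, x₃) dx = 0`, and `f = f₁ + f₂` exactly when `∫ f (1, x₁, x₂, x₃) dx = 0`;
then `S f := S₁ f₁ + S₂ f₂` inherits (S1)–(S4).  This file formalises the splitting, indexing `μ ∈ {0, 1, 2, 3}` by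
`Option (Fin 3)` (`none ↦ g₀ = 1`, `some j ↦ g_j = x_j`):

* `momentFn`, `gramMatrix`, `theta`, `momentPart` — the objects above;
* `dotProduct_gramMatrix_mulVec` — `vᵀ G v = ∫ (Σ_μ v_μ g_μ)² η²`; `gramMatrix_posDef`, `isUnit_gramMatrix` — `G` is
  positive definite, hence invertible, as soon as the continuous compactly supported `η` is not identically zero (an
  affine function vanishing on an open set vanishes identically, `eq_zero_of_affine_eq_zero_on_ball`);
* `integral_theta_mul_momentFn` — biorthogonality `∫ θ^μ g_{μ'} = δ^μ_{μ'}`;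
* `integral_momentPart_mul_momentFn` — the moments of `f_k` vanish; `momentPart_eq_zero_of_notMem` — `f_k = 0` off
  `supp χ_k ∪ supp η`;
* `momentPart_add_momentPart` — `f₁ + f₂ = f − Σ_μ (∫ f g_μ) θ^μ` when `χ₁ + χ₂ = 1` on `supp f` (the paper's display has
  `−Σ_j (∫ f x_j) θ^j` with the opposite sign convention for the `x_j`-terms; the identity used is this one), hence
  `f = f₁ + f₂` under the moment conditions (`momentPart_add_momentPart_of_moments`) and conversely
  (`moments_of_momentPart_add_momentPart`).

Everything is proved; four definitions, no named facts.  The vector case (`T`, moments against `e_l, Y_l`, a `6 × 6`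
Gram matrix) is analogous and not treated here.

## References

* Y. Mao, S.-J. Oh, T. Tao, arXiv:2308.13031 (2023), proof of Lemma 2.2, p. 9 (key `MaoOhTao2023`).
-/

noncomputable section

open scoped RealInnerProductSpace Topology ContDiff Matrix
open Filter MeasureTheory Set Metric Function

namespace Literature.Geometry.Lorentzian

namespace MaoOhTao

/-! ### The moment functions and the Gram matrix -/

/-- The moment functions `g_μ` of the double divergence: `g₀ = 1` (`none`) and `g_j = x_j` (`some j`) — a basis of
the kernel of the formal adjoint of `h ↦ ∂_i∂_j h^{ij}`. [cite: MaoOhTao2023, Lemma 2.2 (proof)] -/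
def momentFn (μ : Option (Fin 3)) (x : E3) : ℝ :=
  μ.elim 1 fun j ↦ x j

/-- `g₀ = 1`. [folklore] -/
@[simp] theorem momentFn_none (x : E3) : momentFn none x = 1 := rfl

/-- `g_j = x_j`. [folklore] -/
@[simp] theorem momentFn_some (j : Fin 3) (x : E3) : momentFn (some j) x = x j := rfl

/-- The moment functions are continuous. [folklore] -/
theorem continuous_momentFn (μ : Option (Fin 3)) : Continuous (momentFn μ) := by
  cases μ with
  | none => exact continuous_const
  | some j => exact (EuclideanSpace.proj (𝕜 := ℝ) j).continuous

/-- The moment functions are smooth. [folklore] -/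
theorem contDiff_momentFn {n : ℕ∞ω} (μ : Option (Fin 3)) : ContDiff ℝ n (momentFn μ) := by
  cases μ with
  | none => exact contDiff_const
  | some j => exact (EuclideanSpace.proj (𝕜 := ℝ) j).contDiff

/-- **The Gram matrix** `G_{μν} = ∫ g_μ g_ν η² dx` of the moment functions with respect to the weight `η²`.
[cite: MaoOhTao2023, Lemma 2.2 (proof)] -/
def gramMatrix (η : E3 → ℝ) : Matrix (Option (Fin 3)) (Option (Fin 3)) ℝ :=
  Matrix.of fun μ ν ↦ ∫ x : E3, momentFn μ x * momentFn ν x * η x ^ 2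

/-- Entries of the Gram matrix. [folklore] -/
theorem gramMatrix_apply (η : E3 → ℝ) (μ ν : Option (Fin 3)) :
    gramMatrix η μ ν = ∫ x : E3, momentFn μ x * momentFn ν x * η x ^ 2 := rfl

/-- The Gram matrix is symmetric. [folklore] -/
theorem gramMatrix_transpose (η : E3 → ℝ) : (gramMatrix η)ᵀ = gramMatrix η := by
  ext μ ν
  simp only [Matrix.transpose_apply, gramMatrix_apply]
  congr 1
  funext x
  ring

variable {η : E3 → ℝ}

/-- Functions vanishing where `η` does are compactly supported when `η` is. [folklore] -/
theorem hasCompactSupport_of_eta (hηc : HasCompactSupport η) {F : E3 → ℝ} (hF : ∀ x, η x = 0 → F x = 0) :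
    HasCompactSupport F :=
  hηc.mono (support_subset_iff'.2 fun x hx ↦ hF x (notMem_support.1 hx))

/-- The Gram integrands `g_μ g_ν η²` are integrable for `η ∈ C_c`. [folklore] -/
theorem integrable_momentFn_mul (hη : Continuous η) (hηc : HasCompactSupport η) (μ ν : Option (Fin 3)) :
    Integrable fun x : E3 ↦ momentFn μ x * momentFn ν x * η x ^ 2 :=
  (((continuous_momentFn μ).mul (continuous_momentFn ν)).mul (hη.pow 2)).integrable_of_hasCompactSupport
    (hasCompactSupport_of_eta hηc fun x hx ↦ by simp [hx])

/-- **The quadratic form of the Gram matrix**: `vᵀ G v = ∫ (Σ_μ v_μ g_μ)² η² dx`. [folklore] -/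
theorem dotProduct_gramMatrix_mulVec (hη : Continuous η) (hηc : HasCompactSupport η) (v : Option (Fin 3) → ℝ) :
    v ⬝ᵥ (gramMatrix η *ᵥ v) = ∫ x : E3, (∑ μ, v μ * momentFn μ x) ^ 2 * η x ^ 2 := by
  have hint : ∀ μ ν, Integrable fun x : E3 ↦ v μ * (momentFn μ x * momentFn ν x * η x ^ 2) * v ν := fun μ ν ↦
    ((integrable_momentFn_mul hη hηc μ ν).const_mul (v μ)).mul_const (v ν)
  simp only [dotProduct, Matrix.mulVec, gramMatrix, Matrix.of_apply]
  have e1 : ∀ μ, v μ * ∑ ν, (∫ x : E3, momentFn μ x * momentFn ν x * η x ^ 2) * v ν =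
      ∫ x : E3, ∑ ν, v μ * (momentFn μ x * momentFn ν x * η x ^ 2) * v ν := by
    intro μ
    rw [integral_finsetSum _ fun ν _ ↦ hint μ ν, Finset.mul_sum]
    refine Finset.sum_congr rfl fun ν _ ↦ ?_
    rw [integral_mul_const, integral_const_mul]
    ring
  rw [Finset.sum_congr rfl fun μ _ ↦ e1 μ, ← integral_finsetSum _ fun μ _ ↦
    integrable_finsetSum _ fun ν _ ↦ hint μ ν]
  refine integral_congr_ae (ae_of_all _ fun x ↦ ?_)
  simp only
  rw [sq (∑ μ, v μ * momentFn μ x), Finset.sum_mul_sum, Finset.sum_mul]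
  refine Finset.sum_congr rfl fun μ _ ↦ ?_
  rw [Finset.sum_mul]
  exact Finset.sum_congr rfl fun ν _ ↦ by ring

/-- **An affine function vanishing on a ball vanishes identically**: if `v₀ + Σ_j v_j x_j = 0` for all `x` in a ball,
then `v = 0`. [folklore] -/
theorem eq_zero_of_affine_eq_zero_on_ball {v : Option (Fin 3) → ℝ} {x₀ : E3} {ε : ℝ} (hε : 0 < ε)
    (h : ∀ x ∈ ball x₀ ε, ∑ μ, v μ * momentFn μ x = 0) : v = 0 := by
  have hx₀ : ∑ μ, v μ * momentFn μ x₀ = 0 := h x₀ (mem_ball_self hε)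
  -- the linear coefficients
  have hsome : ∀ j, v (some j) = 0 := by
    intro j
    set t : ℝ := ε / 2 with ht
    have ht0 : t ≠ 0 := by positivity
    have hmem : x₀ + t • e j ∈ ball x₀ ε := by
      rw [mem_ball, dist_eq_norm, add_sub_cancel_left, norm_smul, Real.norm_eq_abs,
        show ‖e j‖ = 1 by simp [e], mul_one, abs_of_pos (by positivity : 0 < t)]
      linarith
    have h1 := h _ hmem
    have hexp : ∑ μ, v μ * momentFn μ (x₀ + t • e j) = (∑ μ, v μ * momentFn μ x₀) + t * v (some j) := by
      rw [Fintype.sum_option, Fintype.sum_option]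
      simp only [momentFn_none, momentFn_some, PiLp.add_apply, PiLp.smul_apply, smul_eq_mul, e,
        PiLp.single_apply, mul_add, Finset.sum_add_distrib, mul_ite, mul_one, mul_zero,
        Finset.sum_ite_eq', Finset.mem_univ, if_true]
      ring
    rw [hexp, hx₀, zero_add] at h1
    exact (mul_eq_zero.1 h1).resolve_left ht0
  -- the constant coefficient
  have hnone : v none = 0 := by
    rw [Fintype.sum_option] at hx₀
    simpa [hsome] using hx₀
  funext μ
  cases μ with
  | none => exact hnone
  | some j => exact hsome j

/-- **The Gram matrix is positive definite** for a continuous, compactly supported `η` that is not identically zero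
("if `η ≠ 0`, note that `G_{μν}` is positive-definite and in particular invertible"). [cite: MaoOhTao2023, Lemma 2.2 (proof)] -/
theorem gramMatrix_posDef (hη : Continuous η) (hηc : HasCompactSupport η) {x₀ : E3} (hx₀ : η x₀ ≠ 0) :
    (gramMatrix η).PosDef := by
  rw [Matrix.posDef_iff_dotProduct_mulVec]
  refine ⟨?_, fun v hv ↦ ?_⟩
  · show (gramMatrix η)ᴴ = gramMatrix η
    rw [Matrix.conjTranspose_eq_transpose_of_trivial, gramMatrix_transpose]
  rw [star_trivial, dotProduct_gramMatrix_mulVec hη hηc]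
  -- the integrand `(Σ v_μ g_μ)² η²` is continuous, nonnegative, compactly supported and not identically zero
  set F : E3 → ℝ := fun x ↦ (∑ μ, v μ * momentFn μ x) ^ 2 * η x ^ 2 with hF
  have hFc : Continuous F := ((continuous_finsetSum _ fun μ _ ↦ continuous_const.mul
    (continuous_momentFn μ)).pow 2).mul (hη.pow 2)
  have hFs : HasCompactSupport F := hasCompactSupport_of_eta hηc fun x hx ↦ by simp [hF, hx]
  have hF0 : 0 ≤ F := fun x ↦ by positivity
  -- a point where the integrand is nonzero
  obtain ⟨ε, hε, hball⟩ : ∃ ε > 0, ∀ x ∈ ball x₀ ε, η x ≠ 0 := by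
    have hopen : IsOpen {x : E3 | η x ≠ 0} := isOpen_ne_fun hη continuous_const
    obtain ⟨ε, hε, hsub⟩ := Metric.isOpen_iff.1 hopen x₀ hx₀
    exact ⟨ε, hε, fun x hx ↦ hsub hx⟩
  have hex : ∃ x₁ ∈ ball x₀ ε, ∑ μ, v μ * momentFn μ x₁ ≠ 0 := by
    by_contra hcon
    push Not at hcon
    exact hv (eq_zero_of_affine_eq_zero_on_ball hε hcon)
  obtain ⟨x₁, hx₁, ha⟩ := hex
  have hFx : F x₁ ≠ 0 := by
    simp only [hF]
    exact mul_ne_zero (pow_ne_zero 2 ha) (pow_ne_zero 2 (hball x₁ hx₁))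
  exact hFc.integral_pos_of_hasCompactSupport_nonneg_nonzero hFs hF0 hFx

/-- The Gram matrix is invertible. [cite: MaoOhTao2023, Lemma 2.2 (proof)] -/
theorem isUnit_gramMatrix_det (hη : Continuous η) (hηc : HasCompactSupport η) {x₀ : E3} (hx₀ : η x₀ ≠ 0) :
    IsUnit (gramMatrix η).det :=
  (Matrix.isUnit_iff_isUnit_det _).1 (gramMatrix_posDef hη hηc hx₀).isUnit

/-! ### The dual bumps `θ^μ` -/

/-- **The dual bumps** `θ^μ = Σ_ν (G⁻¹)^{μν} g_ν η²`: smooth, supported in `supp η`, biorthogonal to the moment functions.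
[cite: MaoOhTao2023, Lemma 2.2 (proof)] -/
def theta (η : E3 → ℝ) (μ : Option (Fin 3)) (x : E3) : ℝ :=
  ∑ ν, (gramMatrix η)⁻¹ μ ν * momentFn ν x * η x ^ 2

/-- `θ^μ` vanishes where `η` does. [folklore] -/
theorem theta_eq_zero_of_eta (η : E3 → ℝ) (μ : Option (Fin 3)) {x : E3} (hx : η x = 0) : theta η μ x = 0 := by
  simp [theta, hx]

/-- `θ^μ` is continuous for continuous `η`. [folklore] -/
theorem continuous_theta (hη : Continuous η) (μ : Option (Fin 3)) : Continuous (theta η μ) :=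
  continuous_finsetSum _ fun ν _ ↦ (continuous_const.mul (continuous_momentFn ν)).mul (hη.pow 2)

/-- `θ^μ` is as smooth as `η`. [folklore] -/
theorem contDiff_theta {n : ℕ∞ω} (hη : ContDiff ℝ n η) (μ : Option (Fin 3)) : ContDiff ℝ n (theta η μ) :=
  ContDiff.sum fun ν _ ↦ (contDiff_const.mul (contDiff_momentFn ν)).mul (hη.pow 2)

/-- `θ^μ` has compact support (in `supp η`). [folklore] -/
theorem hasCompactSupport_theta (hηc : HasCompactSupport η) (μ : Option (Fin 3)) : HasCompactSupport (theta η μ) :=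
  hasCompactSupport_of_eta hηc fun _ hx ↦ theta_eq_zero_of_eta η μ hx

/-- The topological support of `θ^μ` lies in that of `η`. [folklore] -/
theorem tsupport_theta_subset (η : E3 → ℝ) (μ : Option (Fin 3)) : tsupport (theta η μ) ⊆ tsupport η :=
  closure_mono (support_subset_iff'.2 fun _ hx ↦ theta_eq_zero_of_eta η μ (notMem_support.1 hx))

/-- **Biorthogonality**: `∫ θ^μ g_{μ'} dx = δ^μ_{μ'}` (`= Σ_ν (G⁻¹)^{μν} G_{νμ'} = (G⁻¹G)_{μμ'}`).
[cite: MaoOhTao2023, Lemma 2.2 (proof)] -/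
theorem integral_theta_mul_momentFn (hη : Continuous η) (hηc : HasCompactSupport η) {x₀ : E3} (hx₀ : η x₀ ≠ 0)
    (μ μ' : Option (Fin 3)) :
    ∫ x : E3, theta η μ x * momentFn μ' x = if μ = μ' then 1 else 0 := by
  have hint : ∀ ν, Integrable fun x : E3 ↦ (gramMatrix η)⁻¹ μ ν * (momentFn ν x * momentFn μ' x * η x ^ 2) :=
    fun ν ↦ (integrable_momentFn_mul hη hηc ν μ').const_mul _
  have e1 : (fun x : E3 ↦ theta η μ x * momentFn μ' x) =
      fun x ↦ ∑ ν, (gramMatrix η)⁻¹ μ ν * (momentFn ν x * momentFn μ' x * η x ^ 2) := by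
    funext x
    simp only [theta, Finset.sum_mul]
    exact Finset.sum_congr rfl fun ν _ ↦ by ring
  rw [e1, integral_finsetSum _ fun ν _ ↦ hint ν]
  simp only [integral_const_mul, ← gramMatrix_apply]
  have h := Matrix.nonsing_inv_mul (gramMatrix η) (isUnit_gramMatrix_det hη hηc hx₀)
  have h' := congr_fun (congr_fun h μ) μ'
  rw [Matrix.mul_apply, Matrix.one_apply] at h'
  exact h'

/-! ### The moment-corrected localisation `f_k` -/

/-- **The moment-corrected localisation** `f_k = f χ_k − Σ_μ (∫ f χ_k g_μ) θ^μ` of a density `f` by a cut-off `χ_k`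
(the paper's `f χ_k − (∫ f χ_k) θ⁰ − Σ_j (∫ f χ_k x_j) θ^j`). [cite: MaoOhTao2023, Lemma 2.2 (proof)] -/
def momentPart (η f χ : E3 → ℝ) (x : E3) : ℝ :=
  f x * χ x - ∑ μ, (∫ y : E3, f y * χ y * momentFn μ y) * theta η μ x

variable {f χ : E3 → ℝ}

/-- `f_k = 0` off `supp χ_k ∪ supp η`; in particular `supp f_k ⊆ U_k` when `supp χ_k ⊆ U_k` and `supp η ⊆ U₁ ∩ U₂`.
[cite: MaoOhTao2023, Lemma 2.2 (proof)] -/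
theorem momentPart_eq_zero_of_notMem (η f : E3 → ℝ) {χ : E3 → ℝ} {x : E3} (hχ : χ x = 0) (hηx : η x = 0) :
    momentPart η f χ x = 0 := by
  simp [momentPart, hχ, theta_eq_zero_of_eta η _ hηx]

/-- Support form: `supp f_k ⊆ supp χ_k ∪ supp η`. [cite: MaoOhTao2023, Lemma 2.2 (proof)] -/
theorem support_momentPart_subset (η f χ : E3 → ℝ) :
    support (momentPart η f χ) ⊆ support χ ∪ support η := by
  intro x hx
  by_contra h
  rw [mem_union, not_or, notMem_support, notMem_support] at h
  exact hx (momentPart_eq_zero_of_notMem η f h.1 h.2)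

/-- `f_k` is supported in `U_k` when `supp χ_k ⊆ U_k` and `supp η ⊆ U_k`. [cite: MaoOhTao2023, Lemma 2.2 (proof)] -/
theorem support_momentPart_subset_of {U : Set E3} (hχU : support χ ⊆ U) (hηU : support η ⊆ U) (f : E3 → ℝ) :
    support (momentPart η f χ) ⊆ U :=
  (support_momentPart_subset η f χ).trans (union_subset hχU hηU)

/-- `f_k` is continuous for continuous data. [folklore] -/
theorem continuous_momentPart (hη : Continuous η) (hf : Continuous f) (hχ : Continuous χ) :
    Continuous (momentPart η f χ) :=
  (hf.mul hχ).sub (continuous_finsetSum _ fun μ _ ↦ continuous_const.mul (continuous_theta hη μ))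

/-- `f_k` has compact support when `f` and `η` do. [folklore] -/
theorem hasCompactSupport_momentPart (hηc : HasCompactSupport η) (hfc : HasCompactSupport f) (χ : E3 → ℝ) :
    HasCompactSupport (momentPart η f χ) := by
  refine HasCompactSupport.intro (hfc.union hηc) fun x hx ↦ ?_
  rw [mem_union, not_or] at hx
  have hf0 : f x = 0 := image_eq_zero_of_notMem_tsupport hx.1
  have hη0 : η x = 0 := image_eq_zero_of_notMem_tsupport hx.2
  simp [momentPart, hf0, theta_eq_zero_of_eta η _ hη0]

/-- The localised moments `∫ f χ g_μ` converge for `f ∈ C_c`, `χ ∈ C`. [folklore] -/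
theorem integrable_mul_mul_momentFn (hf : Continuous f) (hfc : HasCompactSupport f) (hχ : Continuous χ)
    (μ : Option (Fin 3)) : Integrable fun y : E3 ↦ f y * χ y * momentFn μ y :=
  ((hf.mul hχ).mul (continuous_momentFn μ)).integrable_of_hasCompactSupport (hfc.mul_right.mul_right)

/-- **The moments of `f_k` vanish**: `∫ f_k g_{μ'} dx = 0` for every `μ'` (biorthogonality of the `θ^μ`).
[cite: MaoOhTao2023, Lemma 2.2 (proof)] -/
theorem integral_momentPart_mul_momentFn (hη : Continuous η) (hηc : HasCompactSupport η) {x₀ : E3}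
    (hx₀ : η x₀ ≠ 0) (hf : Continuous f) (hfc : HasCompactSupport f) (hχ : Continuous χ) (μ' : Option (Fin 3)) :
    ∫ x : E3, momentPart η f χ x * momentFn μ' x = 0 := by
  have h1 : Integrable fun x : E3 ↦ f x * χ x * momentFn μ' x := integrable_mul_mul_momentFn hf hfc hχ μ'
  have h2 : ∀ μ, Integrable fun x : E3 ↦ (∫ y : E3, f y * χ y * momentFn μ y) * (theta η μ x * momentFn μ' x) :=
    fun μ ↦ (((continuous_theta hη μ).mul (continuous_momentFn μ')).integrable_of_hasCompactSupport
      (hasCompactSupport_theta hηc μ).mul_right).const_mul _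
  have e1 : (fun x : E3 ↦ momentPart η f χ x * momentFn μ' x) = fun x ↦
      f x * χ x * momentFn μ' x - ∑ μ, (∫ y : E3, f y * χ y * momentFn μ y) * (theta η μ x * momentFn μ' x) := by
    funext x
    simp only [momentPart, sub_mul, Finset.sum_mul]
    congr 1
    exact Finset.sum_congr rfl fun μ _ ↦ by ring
  rw [e1, integral_sub h1 (integrable_finsetSum _ fun μ _ ↦ h2 μ), integral_finsetSum _ fun μ _ ↦ h2 μ]
  simp only [integral_const_mul, integral_theta_mul_momentFn hη hηc hx₀, mul_ite, mul_one, mul_zero,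
    Finset.sum_ite_eq', Finset.mem_univ, if_true, sub_self]

/-- **The decomposition identity**: if `χ₁ + χ₂ = 1` on `supp f`, then
`f₁ + f₂ = f − Σ_μ (∫ f g_μ) θ^μ`. [cite: MaoOhTao2023, Lemma 2.2 (proof)] -/
theorem momentPart_add_momentPart (hf : Continuous f) (hfc : HasCompactSupport f) {χ₁ χ₂ : E3 → ℝ}
    (hχ₁ : Continuous χ₁) (hχ₂ : Continuous χ₂) (hsum : ∀ x, f x ≠ 0 → χ₁ x + χ₂ x = 1) (x : E3) :
    momentPart η f χ₁ x + momentPart η f χ₂ x = f x - ∑ μ, (∫ y : E3, f y * momentFn μ y) * theta η μ x := by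
  have hpt : ∀ y, f y * χ₁ y + f y * χ₂ y = f y := by
    intro y
    by_cases hy : f y = 0
    · simp [hy]
    · rw [← mul_add, hsum y hy, mul_one]
  have hmom : ∀ μ, (∫ y : E3, f y * χ₁ y * momentFn μ y) + ∫ y : E3, f y * χ₂ y * momentFn μ y =
      ∫ y : E3, f y * momentFn μ y := by
    intro μ
    rw [← integral_add (integrable_mul_mul_momentFn hf hfc hχ₁ μ) (integrable_mul_mul_momentFn hf hfc hχ₂ μ)]
    refine integral_congr_ae (ae_of_all _ fun y ↦ ?_)
    simp only
    rw [← add_mul, hpt y]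
  simp only [momentPart]
  rw [show ∑ μ, (∫ y : E3, f y * momentFn μ y) * theta η μ x =
      ∑ μ, ((∫ y : E3, f y * χ₁ y * momentFn μ y) + ∫ y : E3, f y * χ₂ y * momentFn μ y) * theta η μ x from
    Finset.sum_congr rfl fun μ _ ↦ by rw [hmom μ]]
  simp only [add_mul, Finset.sum_add_distrib]
  linarith [hpt x]

/-- **`f = f₁ + f₂` under the moment conditions** `∫ f (1, x₁, x₂, x₃) dx = 0`.
[cite: MaoOhTao2023, Lemma 2.2 (proof)] -/
theorem momentPart_add_momentPart_of_moments (hf : Continuous f) (hfc : HasCompactSupport f) {χ₁ χ₂ : E3 → ℝ}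
    (hχ₁ : Continuous χ₁) (hχ₂ : Continuous χ₂) (hsum : ∀ x, f x ≠ 0 → χ₁ x + χ₂ x = 1)
    (hmom : ∀ μ, ∫ y : E3, f y * momentFn μ y = 0) (x : E3) :
    momentPart η f χ₁ x + momentPart η f χ₂ x = f x := by
  rw [momentPart_add_momentPart hf hfc hχ₁ hχ₂ hsum x]
  simp [hmom]

/-- **Conversely**, `f = f₁ + f₂` forces the moment conditions (pair with `g_{μ'}` and use the vanishing of the
moments of `f_k`). [cite: MaoOhTao2023, Lemma 2.2 (proof)] -/
theorem moments_of_momentPart_add_momentPart (hη : Continuous η) (hηc : HasCompactSupport η) {x₀ : E3}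
    (hx₀ : η x₀ ≠ 0) (hf : Continuous f) (hfc : HasCompactSupport f) {χ₁ χ₂ : E3 → ℝ} (hχ₁ : Continuous χ₁)
    (hχ₂ : Continuous χ₂) (hdec : ∀ x, momentPart η f χ₁ x + momentPart η f χ₂ x = f x) (μ' : Option (Fin 3)) :
    ∫ y : E3, f y * momentFn μ' y = 0 := by
  have h1 : Integrable fun x : E3 ↦ momentPart η f χ₁ x * momentFn μ' x :=
    ((continuous_momentPart hη hf hχ₁).mul (continuous_momentFn μ')).integrable_of_hasCompactSupport
      (hasCompactSupport_momentPart hηc hfc χ₁).mul_right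
  have h2 : Integrable fun x : E3 ↦ momentPart η f χ₂ x * momentFn μ' x :=
    ((continuous_momentPart hη hf hχ₂).mul (continuous_momentFn μ')).integrable_of_hasCompactSupport
      (hasCompactSupport_momentPart hηc hfc χ₂).mul_right
  calc ∫ y : E3, f y * momentFn μ' y
      = ∫ y : E3, (momentPart η f χ₁ y * momentFn μ' y + momentPart η f χ₂ y * momentFn μ' y) := by
        refine integral_congr_ae (ae_of_all _ fun y ↦ ?_)
        simp only
        rw [← add_mul, hdec y]
    _ = 0 := by
        rw [integral_add h1 h2, integral_momentPart_mul_momentFn hη hηc hx₀ hf hfc hχ₁,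
          integral_momentPart_mul_momentFn hη hηc hx₀ hf hfc hχ₂, add_zero]

end MaoOhTao

end Literature.Geometry.Lorentzian

end
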